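/-
COR-CM (cell pub-hodgecm2, stage 2 of the Hodge ladder) — count-neutral KERNEL COMBINATORICS «order 16: the quaternion doublings `Q₈ × ℤ/2` and
`Q₈ ∘ ℤ/4` (Pauli)», part II: the DATUM (seat prover-pub-hodgecm2-b23-g54-0, binder prover b23, gen 54; claim HOME/INBOX.md l.25095).
Bookkeeping definition with body (`structure QuaternionDoubling.Datum`) + theorems: pure group theory of a group of
order `16` containing `Q₈` with index two and an involution outside acting by an inner automorphism; no CM type yet, no `decide` beyond closed
identities in `ZMod 2`, no certificate, no named fact, no `sorry`.  `Interfaces.lean` (C1), every E term, B01, `Transposition/*`, `PortJoin/*`,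
`D2Bridge/*` untouched.
HONEST FRAMING: `HC_CM` is NOT proved, here or anywhere in the tree; nothing here is a period, a count of record or a headline.
T5: n/a-class (hypothesis binders = the fields of `QuaternionDoubling.Datum`; inhabited by `Q₈ × ℤ/2` (`τ = 0`) and the Pauli group (`τ = 1`),
part «Instance»); checker: self.
-/
import Summits.HodgeConjecture.CorCM.Prior.AllgGroup1

/-!
# The quaternion doublings, II: the datum

A **quaternion doubling datum** for `(G, c)` with TWIST `τ ∈ ℤ/2` (`QuaternionDoubling.Datum G c τ`): elements `i, j, x` with `i` of order `4`,
`i² = j² = c`, `j i j⁻¹ = i⁻¹`, `j ∉ ⟨i⟩` (so `H = ⟨i, j⟩ ≅ Q₈`, §3), `x² = 1`, `x ∉ H`, `x i x = cᵗ i`, `x j x = cᵗ j` (`t = τ`), in a group of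
order `16`.  For `τ = 0` the involution `x` is central and `G ≅ Q₈ × ℤ/2`; for `τ = 1` it acts as conjugation by `k = ij` and `G ≅ Q₈ ∘ ℤ/4`, the
Pauli group (`k x` is central of order `4` with square `c`).
* §2 relations (`c² = 1`, `c ≠ 1`, `j i = c i j`, `(ij)² = c`, `x c = c x`, `x i = cᵗ i x`, `x j = cᵗ j x`, `x (ij) = (ij) x`);
* part IIb (`Census/QuaternionDoublingCore.lean`): the core `H = ⟨i, j⟩ ≅ Q₈` (`|H| = 8`, index two, `x ∉ H`), the normal form `iᵘ jᵛ xᵈ` and the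
  centrality of `c`.
All [folklore].

## References
* [Pohlmann1968] H. Pohlmann, Algebraic cycles on abelian varieties of complex multiplication type, Ann. of Math. 88 (1968), Thm 1.
-/

namespace Summit.HodgeConjecture.CorCM.Census.QuaternionDoubling

open Finset

noncomputable section

variable {G : Type*} [Group G] [Fintype G] [DecidableEq G] {c : G} {τ : ZMod 2}

/-! ## §1 The datum -/

/-- `cᵗ` for `t ∈ ℤ/2`. [folklore] -/
def cpow (c : G) (t : ZMod 2) : G := if t = 0 then 1 else c

/-- **A quaternion doubling datum for `(G, c)` with twist `τ`.** [folklore] -/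
structure Datum (G : Type*) [Group G] (c : G) (τ : ZMod 2) where
  /-- the quaternion unit `i` -/
  i : G
  /-- the quaternion unit `j` -/
  j : G
  /-- the involution outside the core -/
  x : G
  /-- `i` has order `4` -/
  hord_i : orderOf i = 4
  /-- `i² = c` -/
  hii : i * i = c
  /-- `j² = c` -/
  hjj : j * j = c
  /-- `j` inverts `i` -/
  hji : j * i * j⁻¹ = i⁻¹
  /-- `j ∉ ⟨i⟩` -/
  hj : j ∉ Subgroup.zpowers i
  /-- `x` is an involution -/
  hxx : x * x = 1
  /-- `x i x = cᵗ i` -/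
  hxi : x * i * x = cpow c τ * i
  /-- `x j x = cᵗ j` -/
  hxj : x * j * x = cpow c τ * j
  /-- `x` is not a quaternion word -/
  hx : ∀ u v : ℕ, x ≠ i ^ u * j ^ v
  /-- `|G| = 16` -/
  hcard : Nat.card G = 16

variable (D : Datum G c τ)

namespace Datum

include D

/-! ## §2 Relations -/

omit [Fintype G] [DecidableEq G] in
/-- `i⁴ = 1`. [folklore] -/
theorem i_pow_four : D.i ^ 4 = 1 := by rw [← D.hord_i, pow_orderOf_eq_one]

omit [Fintype G] [DecidableEq G] in
/-- `c·c = 1`. [folklore] -/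
theorem c_mul_c : c * c = 1 := by
  rw [← D.hii, show D.i * D.i * (D.i * D.i) = D.i ^ 4 by simp only [pow_succ, pow_zero, one_mul, mul_assoc], D.i_pow_four]

omit [Fintype G] [DecidableEq G] in
/-- `c⁻¹ = c`. [folklore] -/
theorem c_inv : c⁻¹ = c := inv_eq_of_mul_eq_one_right D.c_mul_c

omit [Fintype G] [DecidableEq G] in
/-- `c ≠ 1` (`i` has order `4`, not `2`). [folklore] -/
theorem c_ne_one : c ≠ 1 := by
  intro h
  have h2 : D.i ^ 2 = 1 := by rw [pow_two, D.hii, h]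
  have := orderOf_dvd_of_pow_eq_one h2
  rw [D.hord_i] at this
  omega

omit [Fintype G] [DecidableEq G] in
/-- `i⁻¹ = c i`. [folklore] -/
theorem i_inv : D.i⁻¹ = c * D.i := by
  apply inv_eq_of_mul_eq_one_right
  calc D.i * (c * D.i) = D.i * (D.i * D.i * D.i) := by rw [D.hii]
    _ = D.i ^ 4 := by simp only [pow_succ, pow_zero, one_mul, mul_assoc]
    _ = 1 := D.i_pow_four

omit [Fintype G] [DecidableEq G] in
/-- `j⁻¹ = c j`. [folklore] -/
theorem j_inv : D.j⁻¹ = c * D.j := by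
  apply inv_eq_of_mul_eq_one_right
  calc D.j * (c * D.j) = D.j * (D.j * D.j * D.j) := by rw [D.hjj]
    _ = (D.j * D.j) * (D.j * D.j) := by group
    _ = 1 := by rw [D.hjj, D.c_mul_c]

omit [Fintype G] [DecidableEq G] in
/-- `x⁻¹ = x`. [folklore] -/
theorem x_inv : D.x⁻¹ = D.x := inv_eq_of_mul_eq_one_right D.hxx

omit [Fintype G] [DecidableEq G] in
/-- `i` commutes with `c = i²`. [folklore] -/
theorem commute_i_c : Commute D.i c := by
  show D.i * c = c * D.i
  calc D.i * c = D.i * (D.i * D.i) := by rw [D.hii]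
    _ = (D.i * D.i) * D.i := by group
    _ = c * D.i := by rw [D.hii]

omit [Fintype G] [DecidableEq G] in
/-- `j` commutes with `c = j²`. [folklore] -/
theorem commute_j_c : Commute D.j c := by
  show D.j * c = c * D.j
  calc D.j * c = D.j * (D.j * D.j) := by rw [D.hjj]
    _ = (D.j * D.j) * D.j := by group
    _ = c * D.j := by rw [D.hjj]

omit [Fintype G] [DecidableEq G] in
/-- **`j i = c i j`** (the quaternion relation). [folklore] -/
theorem j_mul_i : D.j * D.i = c * D.i * D.j := by
  calc D.j * D.i = D.j * D.i * D.j⁻¹ * D.j := by rw [inv_mul_cancel_right]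
    _ = c * D.i * D.j := by rw [D.hji, D.i_inv]

omit [Fintype G] [DecidableEq G] in
/-- `i j i = j`. [folklore] -/
theorem i_mul_j_mul_i : D.i * D.j * D.i = D.j := by
  calc D.i * D.j * D.i = D.i * (D.j * D.i) := by group
    _ = D.i * (c * D.i * D.j) := by rw [D.j_mul_i]
    _ = (D.i * c) * D.i * D.j := by group
    _ = (c * D.i) * D.i * D.j := by rw [D.commute_i_c.eq]
    _ = c * (D.i * D.i) * D.j := by group
    _ = D.j := by rw [D.hii, D.c_mul_c, one_mul]

omit [Fintype G] [DecidableEq G] in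
/-- `k := ij` has square `c`. [folklore] -/
theorem ij_mul_ij : D.i * D.j * (D.i * D.j) = c := by
  calc D.i * D.j * (D.i * D.j) = (D.i * D.j * D.i) * D.j := by group
    _ = c := by rw [D.i_mul_j_mul_i, D.hjj]

omit [Fintype G] [DecidableEq G] in
/-- `j` has order `4`. [folklore] -/
theorem orderOf_j : orderOf D.j = 4 := by
  haveI : Fact (Nat.Prime 2) := ⟨Nat.prime_two⟩
  have h := orderOf_eq_prime_pow (p := 2) (n := 1) (x := D.j) (by rw [pow_one, pow_two, D.hjj]; exact D.c_ne_one)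
    (by rw [show 2 ^ (1 + 1) = 2 * 2 by norm_num, pow_mul, pow_two D.j, D.hjj, pow_two, D.c_mul_c])
  simpa using h

omit [Fintype G] [DecidableEq G] in
/-- `cᵗ·cᵗ = 1`. [folklore] -/
theorem cpow_mul_cpow (t : ZMod 2) : cpow c t * cpow c t = 1 := by
  unfold cpow; split_ifs
  · rw [one_mul]
  · exact D.c_mul_c

omit [Fintype G] [DecidableEq G] in
/-- `cᵗ` is `1` or `c`, so it commutes with `i`. [folklore] -/
theorem cpow_comm_i (t : ZMod 2) : cpow c t * D.i = D.i * cpow c t := by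
  unfold cpow; split_ifs
  · rw [one_mul, mul_one]
  · exact D.commute_i_c.eq.symm

omit [Fintype G] [DecidableEq G] in
/-- `cᵗ` commutes with `j`. [folklore] -/
theorem cpow_comm_j (t : ZMod 2) : cpow c t * D.j = D.j * cpow c t := by
  unfold cpow; split_ifs
  · rw [one_mul, mul_one]
  · exact D.commute_j_c.eq.symm

omit [Fintype G] [DecidableEq G] in
/-- **`x i = cᵗ i x`.** [folklore] -/
theorem x_mul_i : D.x * D.i = cpow c τ * D.i * D.x := by
  calc D.x * D.i = D.x * D.i * D.x * D.x := by rw [mul_assoc (D.x * D.i), D.hxx, mul_one]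
    _ = cpow c τ * D.i * D.x := by rw [D.hxi]

omit [Fintype G] [DecidableEq G] in
/-- **`x j = cᵗ j x`.** [folklore] -/
theorem x_mul_j : D.x * D.j = cpow c τ * D.j * D.x := by
  calc D.x * D.j = D.x * D.j * D.x * D.x := by rw [mul_assoc (D.x * D.j), D.hxx, mul_one]
    _ = cpow c τ * D.j * D.x := by rw [D.hxj]

omit [Fintype G] [DecidableEq G] in
/-- **`x` commutes with `c`** (`x c x = (x i x)² = cᵗ i cᵗ i = c`). [folklore] -/
theorem commute_x_c : Commute D.x c := by
  have h1 : D.x * (D.i * D.i) * D.x = (D.x * D.i * D.x) * (D.x * D.i * D.x) := by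
    rw [show (D.x * D.i * D.x) * (D.x * D.i * D.x) = D.x * D.i * (D.x * D.x) * D.i * D.x by group, D.hxx]; group
  have h2 : (D.x * D.i * D.x) * (D.x * D.i * D.x) = c := by
    calc (D.x * D.i * D.x) * (D.x * D.i * D.x) = cpow c τ * D.i * (cpow c τ * D.i) := by rw [D.hxi]
      _ = cpow c τ * (D.i * cpow c τ) * D.i := by group
      _ = cpow c τ * (cpow c τ * D.i) * D.i := by rw [D.cpow_comm_i]
      _ = (cpow c τ * cpow c τ) * (D.i * D.i) := by group
      _ = c := by rw [D.cpow_mul_cpow, one_mul, D.hii]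
  rw [D.hii] at h1
  have h : D.x * c * D.x = c := h1.trans h2
  show D.x * c = c * D.x
  calc D.x * c = D.x * c * D.x * D.x := by rw [mul_assoc (D.x * c), D.hxx, mul_one]
    _ = c * D.x := by rw [h]

omit [Fintype G] [DecidableEq G] in
/-- `cᵗ` commutes with `x`. [folklore] -/
theorem cpow_comm_x (t : ZMod 2) : cpow c t * D.x = D.x * cpow c t := by
  unfold cpow; split_ifs
  · rw [one_mul, mul_one]
  · exact D.commute_x_c.eq.symm

omit [Fintype G] [DecidableEq G] in
/-- **`x` commutes with `k = ij`** (for both twists). [folklore] -/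
theorem x_mul_ij : D.x * (D.i * D.j) = D.i * D.j * D.x := by
  calc D.x * (D.i * D.j) = (D.x * D.i) * D.j := by group
    _ = cpow c τ * D.i * (D.x * D.j) := by rw [D.x_mul_i]; group
    _ = cpow c τ * D.i * (cpow c τ * D.j * D.x) := by rw [D.x_mul_j]
    _ = cpow c τ * (D.i * cpow c τ) * D.j * D.x := by group
    _ = cpow c τ * (cpow c τ * D.i) * D.j * D.x := by rw [D.cpow_comm_i]
    _ = (cpow c τ * cpow c τ) * (D.i * D.j) * D.x := by group
    _ = D.i * D.j * D.x := by rw [D.cpow_mul_cpow, one_mul]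

end Datum

end

end Summit.HodgeConjecture.CorCM.Census.QuaternionDoubling
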